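import Mathlib
import Literature.Computability.AlgebraicComplexity.NestFreeMatchingPoly
import Literature.Barriers.ValiantsHypothesis.MonotoneGapParseTrees
import Summits.ValiantsHypothesis.ValiantsHypothesis.Theorems.FifoMatchingVertexTypedDecomposition
import Summits.ValiantsHypothesis.ValiantsHypothesis.Theorems.FifoMatchingSpreadLawExpBound
import Summits.ValiantsHypothesis.ValiantsHypothesis.Theorems.FifoMatchingNNDivisionHardCorSandwich
import HarnessLib

/-!
# POWERS OF `NN_n` ARE NOT CERTIFICATES: `2^{n^{1/6}} ≤ L₊(NN_n^M)` for all large `n`, UNIFORMLY in `M ≥ 1`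

Route `ValiantsHypothesis/FifoMatching`, helper toward crux stmt-ValiantsHypothesis-21181 (`NNDivisionHard`: every monotone
certificate `(h, NN_n · h)` over `ℝ≥0` costs `L₊(NN_n · h) + L₊(h) > 2^((log₂ n + c)^c)` eventually).

WHY THIS FAMILY.  The open residual of 21181 consists of HYPER-DEGREE cofactors (`deg h > 2^{⌊n^{1/8}⌋}`; the degree-capped
rungs R2 / R2-exp are closed) whose monomials have LARGE support (the small-support engine A + B1 of line `division_split`
is closed); the simplest cofactors with both features are the powers `h = NN_n^M` (and their hope is real elsewhere: for
Valiant's planar dimers `D_n`, `D_n · D_n = det K_n`).  This file shows that for the queue family they buy nothing: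

* `vweight_arcExponent`, `vweight_of_mem_support_pow` — every monomial of `NN_n^M` has VERTEX WEIGHT `M` at every point
  (each point lies on one arc of each matching), so the vertex-typed decomposition of the sibling file applies;
* `nsmul_arcExponent_mem_support_pow` — the PURE monomial `M · χ_P` of every nest-free perfect matching `P` lies in
  `supp NN_n^M` (no cancellation over `ℝ≥0`);
* `respects_of_add_eq_nsmul` — TYPE RIGIDITY: if `α + β = M · χ_P` and `α` has vertex weights `ρ`, then `P` preserves the
  vertex split `S = {ρ ≠ 0}` (an arc of `α` at `i` is the arc `{i, P i}` of `P`, which also weighs on `P i`);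
* ★ `one_le_pow_complexity_mul_of_spread` — the SPREAD LAW for powers: for every probability weighting `μ` of the nest-free
  perfect matchings of `[2n]` (`n ≥ 3`) giving every balanced vertex split mass `≤ β`, `1 ≤ 4 · L₊(NN_n^M) · (n+1)² · β`
  for every `M ≥ 1` (decompose `NN_n^M = Σ_{t<s} a_t b_t`, `s ≤ L₊`, by `VertexTyped.vertexTypedDecomposition`; each `P` is
  captured by the `t` containing its pure monomial and then respects the balanced split `S_t`; union bound);
* ★★ `exp_lower_bound_pow` — **eventually in `n`, `2^{n^{1/6}} ≤ L₊(NN_n^M)` for EVERY `M ≥ 1`** (the abstract thick-queue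
  engine `SpreadLaw.exp_lower_bound_of_spreadLaw` at `F n = min_{M ≥ 1} L₊(NN_n^M)`);
* ★★ `pow_not_certificate`, `pow_not_certificate_qp` — in the currency of the crux: eventually EVERY certificate with a
  power cofactor costs `L₊(NN_n · NN_n^M) + L₊(NN_n^M) ≥ 2^{n^{1/6}} > 2^((log₂ n + c)^c)`, uniformly in `M`.

HONEST FRAMING: one explicit hyper-degree cofactor family is eliminated from the open residual of stmt-21181, by a
support-based (Jerrum–Snir) argument; 21181 stays OPEN; nothing here bears on `NNNotVP` or on VP ≠ VNP (NOT proved).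

References: M. Jerrum, M. Snir, J. ACM 29 (1982) §3 [JerrumSnir1982]; L. G. Valiant, *Negation can be exponentially
powerful*, TCS 12 (1980) [Valiant1980]; P. Hrubeš, A. Yehudayoff, *Shadows of Newton polytopes*, CCC 2021, §6 Problem 2
[HrubesYehudayoff2021].
-/

noncomputable section

-- Sub = Summit single-conjunct layout: the duplicated namespace component is mandated by the tree.
set_option linter.dupNamespace false

namespace Summit.ValiantsHypothesis.ValiantsHypothesis.Theorems.FifoMatching

namespace NNPowers

open Finset MvPolynomial Literature.Computability.AlgebraicComplexity
open Literature.Barriers.ValiantsHypothesis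
open scoped NNReal BigOperators

variable {m : ℕ}

/-! ### §1 Vertex weights of matchings and of the monomials of `NN_n^M` -/

/-- The arc exponent vector of a perfect matching weighs `1` at every point. [folklore] -/
theorem vweight_arcExponent {P : Fin m → Fin m} (hP : P ∈ perfectMatchings m) (i : Fin m) :
    ∑ j, (arcExponent P (i, j) + arcExponent P (j, i)) = 1 := by
  obtain ⟨hinv, hfix⟩ := mem_perfectMatchings.1 hP
  rw [Finset.sum_add_distrib]
  have h1 : ∑ j, arcExponent P (i, j) = if i < P i then 1 else 0 := by
    simp only [arcExponent_apply]
    by_cases h : i < P i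
    · rw [if_pos h, Finset.sum_eq_single (P i) (fun j _ hj => if_neg fun hc => hj hc.2.symm)
        (fun h' => absurd (Finset.mem_univ _) h'), if_pos ⟨h, rfl⟩]
    · rw [if_neg h]
      exact Finset.sum_eq_zero fun j _ => if_neg fun hc => h hc.1
  have h2 : ∑ j, arcExponent P (j, i) = if P i < i then 1 else 0 := by
    simp only [arcExponent_apply]
    rw [Finset.sum_eq_single (P i) (fun j _ hj => if_neg fun hc => hj (by rw [← hc.2, hinv]))
      (fun h' => absurd (Finset.mem_univ _) h')]
    simp only [hinv]
    by_cases h : P i < i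
    · rw [if_pos h, if_pos ⟨h, trivial⟩]
    · rw [if_neg h, if_neg fun hc => h hc.1]
  rw [h1, h2]
  have hne : P i ≠ i := hfix i
  rcases lt_trichotomy i (P i) with hlt | heq | hgt
  · rw [if_pos hlt, if_neg (not_lt.2 hlt.le)]
  · exact absurd heq.symm hne
  · rw [if_neg (not_lt.2 hgt.le), if_pos hgt]

/-- The support of `NN_n` consists of arc exponent vectors of nest-free perfect matchings. [folklore] -/
theorem exists_of_mem_support_nn {n : ℕ} {e : (Fin (2 * n) × Fin (2 * n)) →₀ ℕ}
    (he : e ∈ (nestFreeMatchingPoly n ℝ≥0).support) :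
    ∃ P ∈ nestFreeMatchings (2 * n), arcExponent P = e := by
  rw [nestFreeMatchingPoly_eq_sum_arcMonomial,
    support_sum_arcMonomial nestFreeMatchings_subset_perfectMatchings, Finset.mem_image] at he
  exact he

/-- Every monomial of `NN_n^M` has vertex weight `M` at every point. [folklore] -/
theorem vweight_of_mem_support_pow {n : ℕ} (M : ℕ) {e : (Fin (2 * n) × Fin (2 * n)) →₀ ℕ}
    (he : e ∈ ((nestFreeMatchingPoly n ℝ≥0) ^ M).support) (i : Fin (2 * n)) :
    ∑ j, (e (i, j) + e (j, i)) = M := by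
  induction M generalizing e with
  | zero =>
    rw [pow_zero] at he
    have h0 : e = 0 := by
      classical
      have := support_one (R := ℝ≥0) (σ := Fin (2 * n) × Fin (2 * n))
      rw [this] at he
      simpa using he
    subst h0
    simp
  | succ M ih =>
    rw [pow_succ] at he
    classical
    obtain ⟨a, ha, b, hb, rfl⟩ := Finset.mem_add.1 (support_mul _ _ he)
    obtain ⟨P, hP, rfl⟩ := exists_of_mem_support_nn hb
    have hPa := vweight_arcExponent (nestFreeMatchings_subset_perfectMatchings hP) i
    have hA := ih ha
    simp only [Finsupp.coe_add, Pi.add_apply, Finset.sum_add_distrib] at hPa hA ⊢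
    omega

/-! ### §2 Pure monomials and type rigidity -/

/-- The PURE monomial `M · χ_P` of a nest-free perfect matching lies in `supp NN_n^M` (no cancellation over `ℝ≥0`:
`supp (f g) = supp f + supp g`). [cite: JerrumSnir1982, §2.2] -/
theorem nsmul_arcExponent_mem_support_pow {n : ℕ} (M : ℕ) {P : Fin (2 * n) → Fin (2 * n)}
    (hP : P ∈ nestFreeMatchings (2 * n)) :
    M • arcExponent P ∈ ((nestFreeMatchingPoly n ℝ≥0) ^ M).support := by
  induction M with
  | zero =>
    rw [pow_zero, zero_smul, mem_support_iff, coeff_one, if_pos rfl]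
    exact one_ne_zero
  | succ M ih =>
    rw [pow_succ, JerrumSnir.support_mul_eq, succ_nsmul]
    refine Finset.add_mem_add ih ?_
    rw [nestFreeMatchingPoly_eq_sum_arcMonomial,
      support_sum_arcMonomial nestFreeMatchings_subset_perfectMatchings]
    exact Finset.mem_image_of_mem _ hP

/-- **TYPE RIGIDITY.**  If `α + β = M · χ_P` for a perfect matching `P` and `α` has vertex weights `ρ`, then `P` preserves the
vertex split `{i | ρ i ≠ 0}`: the only entries of `α` are on arcs `(i, P i)` of `P`, and such an arc weighs on both ends.
[folklore] -/
theorem respects_of_add_eq_nsmul {P : Fin m → Fin m} (hP : P ∈ perfectMatchings m) {M : ℕ}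
    {α β : (Fin m × Fin m) →₀ ℕ} (h : α + β = M • arcExponent P) {ρ : Fin m → ℕ}
    (hρ : ∀ i, ∑ j, (α (i, j) + α (j, i)) = ρ i) :
    ∀ i, ρ i ≠ 0 ↔ ρ (P i) ≠ 0 := by
  obtain ⟨hinv, -⟩ := mem_perfectMatchings.1 hP
  -- the only possibly nonzero entries of `α` are on arcs of `P`
  have hle : ∀ i j, α (i, j) ≠ 0 → i < P i ∧ P i = j := by
    intro i j hij
    have hsum : (M • arcExponent P) (i, j) ≠ 0 := by
      rw [← h]; simp only [Finsupp.coe_add, Pi.add_apply]; omega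
    rw [Finsupp.smul_apply, smul_eq_mul, arcExponent_apply] at hsum
    by_contra hc
    exact hsum (by rw [if_neg hc, mul_zero])
  -- `ρ i ≠ 0 ↔ α (i, P i) ≠ 0 ∨ α (P i, i) ≠ 0`
  have key : ∀ i, ρ i ≠ 0 ↔ α (i, P i) ≠ 0 ∨ α (P i, i) ≠ 0 := by
    intro i
    rw [← hρ i]
    constructor
    · intro hs
      obtain ⟨j, -, hj⟩ := Finset.exists_ne_zero_of_sum_ne_zero hs
      by_cases h1 : α (i, j) ≠ 0
      · exact Or.inl (by rw [← (hle i j h1).2] at h1; exact h1)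
      · have h2 : α (j, i) ≠ 0 := by omega
        have hji := (hle j i h2).2
        have : j = P i := by rw [← hji, hinv]
        subst this
        exact Or.inr h2
    · intro hor hs
      have hterm := Finset.sum_eq_zero_iff.mp hs (P i) (Finset.mem_univ _)
      rcases hor with h1 | h2 <;> omega
  intro i
  rw [key i, key (P i), hinv]
  exact Or.comm

/-! ### §3 The spread law for powers -/

/-- ★ **THE SPREAD LAW FOR POWERS.**  For `n ≥ 3`, `M ≥ 1` and every probability weighting `μ` of the nest-free perfect
matchings of `[2n]` under which every balanced vertex split (`2n < 3|S| ≤ 4n`) is respected with mass `≤ β`: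
`1 ≤ 4 · L₊(NN_n^M) · (n+1)² · β` (indeed `1 ≤ L₊(NN_n^M) · β`).  Proof: vertex-typed decomposition of `NN_n^M`
(`VertexTyped.vertexTypedDecomposition`, weights all `= M`), capture of each `P` by the product containing its pure monomial,
type rigidity, union bound. [cite: JerrumSnir1982, §3 (Thm. 3.2) and §4.3] -/
theorem one_le_pow_complexity_mul_of_spread {n : ℕ} (hn : 3 ≤ n) {β : ℝ≥0}
    (μ : (Fin (2 * n) → Fin (2 * n)) → ℝ≥0) (hμ : ∑ P ∈ nestFreeMatchings (2 * n), μ P = 1)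
    (hβ : ∀ S : Finset (Fin (2 * n)), 2 * n < 3 * S.card → 3 * S.card ≤ 4 * n →
      (∑ P ∈ (nestFreeMatchings (2 * n)).filter (fun P => ∀ i, i ∈ S ↔ P i ∈ S), μ P) ≤ β)
    (M : ℕ) (hM : 1 ≤ M) :
    (1 : ℝ) ≤ 4 * (complexity ((nestFreeMatchingPoly n ℝ≥0) ^ M) : ℝ) * ((n : ℝ) + 1) ^ 2 * (β : ℝ) := by
  classical
  set g := (nestFreeMatchingPoly n ℝ≥0) ^ M with hg
  -- the vertex-typed decomposition
  obtain ⟨s, hs, a, b, hsum, htyp⟩ := VertexTyped.vertexTypedDecomposition (N := 2 * n) (by omega) g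
    (fun _ => M) (fun e he i => vweight_of_mem_support_pow M he i) (fun _ => by omega)
  choose ρ hρ hlo hhi using htyp
  -- every nest-free perfect matching respects the split of the product capturing its pure monomial
  have hcap : ∀ P ∈ nestFreeMatchings (2 * n),
      ∃ t : Fin s, ∀ i, i ∈ (Finset.univ.filter fun i => ρ t i ≠ 0) ↔
        P i ∈ (Finset.univ.filter fun i => ρ t i ≠ 0) := by
    intro P hP
    have hmem : M • arcExponent P ∈ g.support := nsmul_arcExponent_mem_support_pow M hP
    rw [hsum] at hmem
    obtain ⟨t, -, ht⟩ := Finset.mem_biUnion.1 (support_sum hmem)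
    rw [JerrumSnir.support_mul_eq] at ht
    obtain ⟨α, hα, β', -, hαβ⟩ := Finset.mem_add.1 ht
    refine ⟨t, fun i => ?_⟩
    simp only [Finset.mem_filter, Finset.mem_univ, true_and]
    exact respects_of_add_eq_nsmul (nestFreeMatchings_subset_perfectMatchings hP) hαβ (hρ t α hα) i
  -- union bound in `ℝ≥0`: `1 = Σ_P μ P ≤ Σ_t μ(E_{S_t}) ≤ s β`
  have hE : ∀ t : Fin s,
      (∑ P ∈ (nestFreeMatchings (2 * n)).filter
        (fun P => ∀ i, i ∈ (Finset.univ.filter fun i => ρ t i ≠ 0) ↔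
          P i ∈ (Finset.univ.filter fun i => ρ t i ≠ 0)), μ P) ≤ β :=
    fun t => hβ _ (hlo t) (by have := hhi t; omega)
  have h1 : (1 : ℝ≥0) ≤ (s : ℝ≥0) * β := by
    calc (1 : ℝ≥0) = ∑ P ∈ nestFreeMatchings (2 * n), μ P := hμ.symm
      _ ≤ ∑ P ∈ nestFreeMatchings (2 * n), ∑ t : Fin s,
            (if (∀ i, i ∈ (Finset.univ.filter fun i => ρ t i ≠ 0) ↔
                P i ∈ (Finset.univ.filter fun i => ρ t i ≠ 0)) then μ P else 0) := by
          refine Finset.sum_le_sum fun P hP => ?_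
          obtain ⟨t, ht⟩ := hcap P hP
          refine le_trans ?_ (Finset.single_le_sum (f := fun t : Fin s =>
            if (∀ i, i ∈ (Finset.univ.filter fun i => ρ t i ≠ 0) ↔
                P i ∈ (Finset.univ.filter fun i => ρ t i ≠ 0)) then μ P else 0)
            (fun _ _ => zero_le) (Finset.mem_univ t))
          simp only [if_pos ht, le_refl]
      _ = ∑ t : Fin s, ∑ P ∈ nestFreeMatchings (2 * n),
            (if (∀ i, i ∈ (Finset.univ.filter fun i => ρ t i ≠ 0) ↔
                P i ∈ (Finset.univ.filter fun i => ρ t i ≠ 0)) then μ P else 0) := Finset.sum_comm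
      _ = ∑ t : Fin s, (∑ P ∈ (nestFreeMatchings (2 * n)).filter
            (fun P => ∀ i, i ∈ (Finset.univ.filter fun i => ρ t i ≠ 0) ↔
              P i ∈ (Finset.univ.filter fun i => ρ t i ≠ 0)), μ P) := by
          refine Finset.sum_congr rfl fun t _ => ?_
          rw [Finset.sum_filter]
      _ ≤ ∑ _t : Fin s, β := Finset.sum_le_sum fun t _ => hE t
      _ = (s : ℝ≥0) * β := by simp
  -- conclude in `ℝ`
  have h1' : (1 : ℝ) ≤ (s : ℝ) * (β : ℝ) := by exact_mod_cast h1
  have hsL : (s : ℝ) ≤ (complexity g : ℝ) := by exact_mod_cast hs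
  have hβ0 : (0 : ℝ) ≤ β := β.coe_nonneg
  have hL0 : (0 : ℝ) ≤ (complexity g : ℝ) := Nat.cast_nonneg _
  have hn1 : (1 : ℝ) ≤ ((n : ℝ) + 1) ^ 2 := by
    have : (1 : ℝ) ≤ (n : ℝ) + 1 := by
      have : (0 : ℝ) ≤ n := Nat.cast_nonneg n
      linarith
    nlinarith
  calc (1 : ℝ) ≤ (s : ℝ) * β := h1'
    _ ≤ (complexity g : ℝ) * β := mul_le_mul_of_nonneg_right hsL hβ0
    _ = 1 * (complexity g : ℝ) * 1 * β := by ring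
    _ ≤ 4 * (complexity g : ℝ) * ((n : ℝ) + 1) ^ 2 * β := by
        gcongr
        norm_num

/-! ### §4 The exponential bound, uniformly in the exponent, and the certificate reading -/

/-- ★★ **POWERS OF `NN_n` ARE EXPONENTIALLY HARD, UNIFORMLY**: there is `n₀` such that `2^{n^{1/6}} ≤ L₊(NN_n^M)` for all
`n ≥ n₀` and ALL `M ≥ 1` (the abstract thick-queue engine at `F n = min_{M ≥ 1} L₊(NN_n^M)`, which obeys the spread law by
`one_le_pow_complexity_mul_of_spread`). [cite: JerrumSnir1982, §4.3] [cite: Valiant1980, §3] -/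
theorem exp_lower_bound_pow : ∃ n₀ : ℕ, ∀ n : ℕ, n₀ ≤ n → ∀ M : ℕ, 1 ≤ M →
    (2 : ℝ) ^ ((n : ℝ) ^ ((1 : ℝ) / 6)) ≤ (complexity ((nestFreeMatchingPoly n ℝ≥0) ^ M) : ℝ) := by
  set F : ℕ → ℕ := fun n => sInf (Set.range fun M : ℕ => complexity ((nestFreeMatchingPoly n ℝ≥0) ^ (M + 1)))
    with hF
  have hmem : ∀ n, F n ∈ Set.range fun M : ℕ => complexity ((nestFreeMatchingPoly n ℝ≥0) ^ (M + 1)) :=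
    fun n => Nat.sInf_mem ⟨_, ⟨0, rfl⟩⟩
  have hlaw := SpreadLaw.exp_lower_bound_of_spreadLaw F (fun n hn β μ hμ hS => by
    obtain ⟨M, hM⟩ := hmem n
    rw [← hM]
    exact one_le_pow_complexity_mul_of_spread hn μ hμ hS (M + 1) (by omega))
  obtain ⟨n₀, hn₀⟩ := hlaw
  refine ⟨n₀, fun n hn M hM => ?_⟩
  obtain ⟨M', rfl⟩ : ∃ M', M = M' + 1 := ⟨M - 1, by omega⟩
  have hle : F n ≤ complexity ((nestFreeMatchingPoly n ℝ≥0) ^ (M' + 1)) := Nat.sInf_le ⟨M', rfl⟩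
  exact (hn₀ n hn).trans (by exact_mod_cast hle)

/-- ★★ **POWERS ARE NOT CERTIFICATES** (currency of stmt-21181): eventually in `n`, every certificate with a power
cofactor `h = NN_n^M` costs `L₊(NN_n · NN_n^M) + L₊(NN_n^M) ≥ 2^{n^{1/6}}`, uniformly in `M ≥ 0`. [cite: JerrumSnir1982, §4.3] -/
theorem pow_not_certificate : ∃ n₀ : ℕ, ∀ n : ℕ, n₀ ≤ n → ∀ M : ℕ,
    (2 : ℝ) ^ ((n : ℝ) ^ ((1 : ℝ) / 6)) ≤
      ((complexity (nestFreeMatchingPoly n ℝ≥0 * (nestFreeMatchingPoly n ℝ≥0) ^ M) +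
        complexity ((nestFreeMatchingPoly n ℝ≥0) ^ M) : ℕ) : ℝ) := by
  obtain ⟨n₀, hn₀⟩ := exp_lower_bound_pow
  refine ⟨n₀, fun n hn M => ?_⟩
  have h := hn₀ n hn (M + 1) (by omega)
  rw [pow_succ'] at h
  exact h.trans (by exact_mod_cast Nat.le_add_right _ _)

/-- ★★ **POWERS ARE NOT CERTIFICATES, quasi-polynomial reading**: for every `c`, eventually in `n`,
`2^((log₂ n + c)^c) < L₊(NN_n · NN_n^M) + L₊(NN_n^M)` for EVERY `M` — the instance `h ∈ {NN_n^M}` of the route decl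
`Theses.FifoMatching.NNDivisionHard` (whose inlined `NN_n` is definitionally `nestFreeMatchingPoly n ℝ≥0`), PROVED uniformly
in the exponent. [cite: JerrumSnir1982, §4.3] [cite: HrubesYehudayoff2021, §6 Problem 2] -/
theorem pow_not_certificate_qp (c : ℕ) : ∃ n₀ : ℕ, ∀ n : ℕ, n₀ ≤ n → ∀ M : ℕ,
    2 ^ ((Nat.log 2 n + c) ^ c) <
      complexity (nestFreeMatchingPoly n ℝ≥0 * (nestFreeMatchingPoly n ℝ≥0) ^ M) +
        complexity ((nestFreeMatchingPoly n ℝ≥0) ^ M) := by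
  obtain ⟨n₁, hn₁⟩ := pow_not_certificate
  obtain ⟨n₂, hn₂⟩ := CorSandwich.polylog_lt_rpow_eventually c (c := 1 / 6) (by norm_num)
  refine ⟨max n₁ n₂, fun n hn M => ?_⟩
  have h1 := hn₁ n (le_of_max_le_left hn) M
  have h2 := hn₂ n (le_of_max_le_right hn)
  have h3 : (2 : ℝ) ^ (((Nat.log 2 n + c) ^ c : ℕ) : ℝ) < (2 : ℝ) ^ ((n : ℝ) ^ ((1 : ℝ) / 6)) :=
    Real.rpow_lt_rpow_of_exponent_lt (by norm_num) h2
  have h4 : ((2 ^ ((Nat.log 2 n + c) ^ c) : ℕ) : ℝ) <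
      ((complexity (nestFreeMatchingPoly n ℝ≥0 * (nestFreeMatchingPoly n ℝ≥0) ^ M) +
        complexity ((nestFreeMatchingPoly n ℝ≥0) ^ M) : ℕ) : ℝ) := by
    rw [Nat.cast_pow, Nat.cast_ofNat, ← Real.rpow_natCast]
    exact h3.trans_le h1
  exact_mod_cast h4

end NNPowers

end Summit.ValiantsHypothesis.ValiantsHypothesis.Theorems.FifoMatching

end
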